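import Mathlib
import Summits.KontsevichZagierPeriods.KontsevichZagierPeriods.Theorems.InverseLandauTateLiftingPolytopeSector
import Summits.KontsevichZagierPeriods.KontsevichZagierPeriods.Theorems.InverseLandauTateLiftingPolytopeUnion
import Summits.KontsevichZagierPeriods.KontsevichZagierPeriods.Theorems.InverseLandauTateLiftingEllipsoidKernel
import Summits.KontsevichZagierPeriods.KontsevichZagierPeriods.Theorems.InverseLandauTateLiftingConeEngine
import Summits.KontsevichZagierPeriods.KontsevichZagierPeriods.Theorems.InverseLandauTateLiftingFubiniReduction
import Summits.KontsevichZagierPeriods.KontsevichZagierPeriods.Theorems.BetaCancellation.Negative.Torsion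

/-!
# `TateLifting` (stmt-KontsevichZagierPeriods-9129), line `Sketch` — SOLID GEOMETRY INSIDE THE RULES:
# polytopes as sets, ellipsoids, cones

Assembly of stubs 56–58 of the line (`tateLifting_polytopeUnion`, `tateLifting_ellipsoidKernel`,
`tateLifting_coneEngine`) with the landed polytope sector (`kzPeriodConjecture_polytope`, p137523):

* `kzPeriodConjecture_polytopeSet` — **KZ's Conjecture 1 for POLYTOPES GIVEN AS SETS**: two representations (any two
  dimensions) whose domains are finite unions of closed real-algebraic simplices `convexHull ℝ {v₀..v_N}` with null
  pairwise overlaps, with `K`-polynomial integrands on them (e.g. `1`), and the same value, are KZ-equivalent — volume is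
  the only invariant, no Dehn invariant;
* `kzPeriodConjecture_ellipsoid` — **two ELLIPSOIDS of any two dimensions (real-algebraic affine images of closed unit
  balls, integrand `1`) with the same volume are KZ-equivalent** (Lindemann enters through the landed ball sector);
* `coneKernel`, `TateLifting_coneSector` — **CONE KERNEL TRANSFER** with no transcendence input: if Conjecture 1 (kernel
  form) holds on `closure S`, it holds on the cones `Cone σ = {z ∈ ℝⁿ⁺¹ | 0 < z_n < 1, (z₀..z_{n−1})/z_n ∈ σ}` over
  bases `[σ, 1]` reducing to `closure S` ("volume of a cone = base × height/(n+1)" inside the rules: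
  `(n+1)·[Cone σ] − [σ] ∈ relations`, then the torsion-freeness of `FormalRep ⧸ relations`).

Design: no definitions. References: M. Kontsevich, D. Zagier, *Periods* (2001), §1.2; M. Dehn, Math. Ann. 55 (1901).
-/

noncomputable section

namespace Summit.KontsevichZagierPeriods.InverseLandau

open MeasureTheory Set
open Literature.NumberTheory.Transcendental

/-- **KZ's CONJECTURE 1 FOR POLYTOPES GIVEN AS SETS** (stub 56 + `kzPeriodConjecture_polytope`): two representations
whose domains are finite unions of closed real-algebraic simplices with null pairwise overlaps (any two dimensions),
with `K`-polynomial integrands on them and the same value, are KZ-equivalent. [cite: KontsevichZagier2001, §1.2] -/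
theorem kzPeriodConjecture_polytopeSet {N M k l : ℕ}
    (V : Fin k → Fin (N + 1) → (Fin N → ℝ)) (W : Fin l → Fin (M + 1) → (Fin M → ℝ))
    (r : KZ.IntegralRep N) (r' : KZ.IntegralRep M)
    (P : MvPolynomial (Fin N) (algebraicClosure ℚ ℝ)) (P' : MvPolynomial (Fin M) (algebraicClosure ℚ ℝ))
    (hV : ∀ i, AffineIndependent ℝ (V i)) (hVa : ∀ i a c, IsAlgebraic ℚ (V i a c))
    (hdom : r.domain = ⋃ i, convexHull ℝ (Set.range (V i)))
    (hov : ∀ i j, i ≠ j → volume (convexHull ℝ (Set.range (V i)) ∩ convexHull ℝ (Set.range (V j))) = 0)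
    (hint : Set.EqOn r.integrand (fun z => (MvPolynomial.aeval z P : ℝ)) r.domain)
    (hW : ∀ i, AffineIndependent ℝ (W i)) (hWa : ∀ i a c, IsAlgebraic ℚ (W i a c))
    (hdom' : r'.domain = ⋃ i, convexHull ℝ (Set.range (W i)))
    (hov' : ∀ i j, i ≠ j → volume (convexHull ℝ (Set.range (W i)) ∩ convexHull ℝ (Set.range (W j))) = 0)
    (hint' : Set.EqOn r'.integrand (fun z => (MvPolynomial.aeval z P' : ℝ)) r'.domain)
    (hv : r.value = r'.value) : KZ.Equivalent r r' := by
  obtain ⟨R, hRd, hRi, hRcov, hRdisj⟩ := tateLifting_polytopeUnion N k V r hV hVa hdom hov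
  obtain ⟨R', hRd', hRi', hRcov', hRdisj'⟩ := tateLifting_polytopeUnion M l W r' hW hWa hdom' hov'
  have hsubR : ∀ i, (R i).domain ⊆ r.domain := fun i => by
    rw [hRd, hdom]
    exact interior_subset.trans (Set.subset_iUnion (fun i => convexHull ℝ (Set.range (V i))) i)
  have hsubR' : ∀ i, (R' i).domain ⊆ r'.domain := fun i => by
    rw [hRd', hdom']
    exact interior_subset.trans (Set.subset_iUnion (fun i => convexHull ℝ (Set.range (W i))) i)
  refine kzPeriodConjecture_polytope Finset.univ Finset.univ r R r' R'
    (fun i _ => by rw [Set.sdiff_eq_empty.mpr (hsubR i), measure_empty])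
    (fun i _ x hx => by rw [hRi]) hRcov hRdisj (fun i _ => ?_)
    (fun i _ => by rw [Set.sdiff_eq_empty.mpr (hsubR' i), measure_empty])
    (fun i _ x hx => by rw [hRi']) hRcov' hRdisj' (fun i _ => ?_) hv
  · obtain ⟨hdet, hhull⟩ := tateLifting_simplexHull N (V i) (hV i)
    refine ⟨Matrix.of fun a c : Fin N => V i c.succ a - V i (Fin.castSucc c) a, V i 0, P, fun a c => ?_,
      fun a => hVa i 0 a, hdet, by rw [hRd, hhull], fun x hx => ?_⟩
    · rw [Matrix.of_apply]; exact (hVa _ _ _).sub (hVa _ _ _)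
    · rw [hRi]; exact hint (hsubR i hx)
  · obtain ⟨hdet, hhull⟩ := tateLifting_simplexHull M (W i) (hW i)
    refine ⟨Matrix.of fun a c : Fin M => W i c.succ a - W i (Fin.castSucc c) a, W i 0, P', fun a c => ?_,
      fun a => hWa i 0 a, hdet, by rw [hRd', hhull], fun x hx => ?_⟩
    · rw [Matrix.of_apply]; exact (hWa _ _ _).sub (hWa _ _ _)
    · rw [hRi']; exact hint' (hsubR' i hx)

/-- **Two ELLIPSOIDS of any two dimensions (real-algebraic affine images of closed unit balls, integrand `1`) with
the same volume are KZ-equivalent** (stub 57; Lindemann through the landed ball sector `ballKernel`).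
[cite: KontsevichZagier2001, §1.2] -/
theorem kzPeriodConjecture_ellipsoid :
    ∀ {n m : ℕ} (A : Matrix (Fin n) (Fin n) ℝ) (b : Fin n → ℝ) (A' : Matrix (Fin m) (Fin m) ℝ) (b' : Fin m → ℝ)
      (r : KZ.IntegralRep n) (r' : KZ.IntegralRep m),
      (∀ i j, IsAlgebraic ℚ (A i j)) → (∀ i, IsAlgebraic ℚ (b i)) → A.det ≠ 0 →
      r.domain = (fun x => A.mulVec x + b) '' {x | ∑ i, x i ^ 2 ≤ 1} → (∀ y ∈ r.domain, r.integrand y = 1) →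
      (∀ i j, IsAlgebraic ℚ (A' i j)) → (∀ i, IsAlgebraic ℚ (b' i)) → A'.det ≠ 0 →
      r'.domain = (fun x => A'.mulVec x + b') '' {x | ∑ i, x i ^ 2 ≤ 1} → (∀ y ∈ r'.domain, r'.integrand y = 1) →
      r.value = r'.value → KZ.Equivalent r r' :=
  fun A b A' b' r r' hAa hba hdet hdom hri hAa' hba' hdet' hdom' hri' hv =>
    Fubini.equivalent_of_kernel tateLifting_ellipsoidKernel (Or.inl ⟨_, A, b, r, hAa, hba, hdet, hdom, hri, rfl⟩)
      (Or.inl ⟨_, A', b', r', hAa', hba', hdet', hdom', hri', rfl⟩) hv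

/-- **CONE KERNEL TRANSFER** (stub 58): if Conjecture 1 (kernel form) holds on `closure S`, it holds on `closure B`
for every set `B` of integrand-`1` cone representations (dimension `n + 1`) whose bases reduce to `closure S` modulo
relations — multiply by `n + 1`, reduce to the bases by `tateLifting_coneEngine`, divide by `n + 1` using the
torsion-freeness of `FormalRep ⧸ relations` (`BetaCancellationNegative.zsmul_mem_relations_iff`). No transcendence
input. [cite: KontsevichZagier2001, §1.2] -/
theorem coneKernel (S B : Set KZ.FormalRep) (n : ℕ)
    (hB : ∀ d ∈ B, ∃ (r : KZ.IntegralRep (n + 1)) (s : KZ.IntegralRep n),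
      r.domain = {z | z (Fin.last n) ∈ Set.Ioo (0 : ℝ) 1 ∧
        (fun i => (Fin.init z : Fin n → ℝ) i / z (Fin.last n)) ∈ s.domain} ∧
      (∀ z ∈ r.domain, r.integrand z = 1) ∧ (∀ x ∈ s.domain, s.integrand x = 1) ∧
      (∃ ℓ ∈ AddSubgroup.closure S, KZ.of s - ℓ ∈ KZ.relations) ∧ d = KZ.of r)
    (hK : ∀ c ∈ AddSubgroup.closure S, KZ.eval c = 0 → c ∈ KZ.relations) :
    ∀ c ∈ AddSubgroup.closure B, KZ.eval c = 0 → c ∈ KZ.relations := by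
  intro c hc hev
  classical
  rw [← Submodule.span_int_eq_addSubgroupClosure, Submodule.mem_toAddSubgroup,
    Submodule.mem_span_set'] at hc
  obtain ⟨k, f, g, rfl⟩ := hc
  have hred : ∀ d ∈ B, ∃ ℓ ∈ AddSubgroup.closure S,
      ((n + 1 : ℕ) : ℤ) • d - ℓ ∈ KZ.relations := by
    intro d hd
    obtain ⟨r, s, hrd, hri, hsi, ⟨ℓ, hℓ, hsℓ⟩, rfl⟩ := hB d hd
    refine ⟨ℓ, hℓ, ?_⟩
    have : ((n + 1 : ℕ) : ℤ) • KZ.of r - ℓ = (((n + 1 : ℕ) : ℤ) • KZ.of r - KZ.of s) + (KZ.of s - ℓ) := by abel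
    rw [this]
    exact KZ.relations.add_mem (tateLifting_coneEngine n r s hrd hri hsi) hsℓ
  choose ℓ hℓ hrel using fun i => hred (g i) (g i).2
  have hdiff : ((n + 1 : ℕ) : ℤ) • ∑ i, f i • ((g i : KZ.FormalRep)) - ∑ i, f i • ℓ i ∈ KZ.relations := by
    rw [Finset.smul_sum, ← Finset.sum_sub_distrib]
    refine sum_mem fun i _ => ?_
    rw [smul_comm, ← smul_sub]
    exact KZ.relations.zsmul_mem (hrel i) _
  have hmem : ∑ i, f i • ℓ i ∈ AddSubgroup.closure S :=
    sum_mem fun i _ => AddSubgroup.zsmul_mem _ (hℓ i) _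
  have hev' : KZ.eval (∑ i, f i • ℓ i) = 0 := by
    have h0 := KZ.relations_le_ker_eval_holds hdiff
    rw [AddMonoidHom.mem_ker, map_sub, map_zsmul, hev, smul_zero, zero_sub, neg_eq_zero] at h0
    exact h0
  have h := KZ.relations.add_mem hdiff (hK _ hmem hev')
  rw [sub_add_cancel] at h
  exact (Summit.KontsevichZagierPeriods.KontsevichZagierPeriods.BetaCancellationNegative.zsmul_mem_relations_iff
    (by positivity) _).1 h

/-- **The crux `TateLifting` on the cones over a kernel sector** (in fact inside `KZ.relations`).
[cite: KontsevichZagier2001, §1.2] -/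
theorem TateLifting_coneSector (S B : Set KZ.FormalRep) (n : ℕ)
    (hB : ∀ d ∈ B, ∃ (r : KZ.IntegralRep (n + 1)) (s : KZ.IntegralRep n),
      r.domain = {z | z (Fin.last n) ∈ Set.Ioo (0 : ℝ) 1 ∧
        (fun i => (Fin.init z : Fin n → ℝ) i / z (Fin.last n)) ∈ s.domain} ∧
      (∀ z ∈ r.domain, r.integrand z = 1) ∧ (∀ x ∈ s.domain, s.integrand x = 1) ∧
      (∃ ℓ ∈ AddSubgroup.closure S, KZ.of s - ℓ ∈ KZ.relations) ∧ d = KZ.of r)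
    (hK : ∀ c ∈ AddSubgroup.closure S, KZ.eval c = 0 → c ∈ KZ.relations) (T : Set KZ.FormalRep) :
    ∀ c ∈ AddSubgroup.closure B, KZ.eval c = 0 → c ∈ KZ.relations ⊔ AddSubgroup.closure T :=
  fun c hc h0 => AddSubgroup.mem_sup_left (coneKernel S B n hB hK c hc h0)

/-- **CONE KERNEL TRANSFER IN ALL DIMENSIONS AT ONCE** (cones of different dimensions mixed): if Conjecture 1 (kernel form) holds on
`closure S`, it holds on `closure B` for every set `B` of integrand-`1` cone representations of ANY dimensions whose bases reduce to
`closure S` — multiply the vanishing combination by the least common multiple `L` of the `nᵢ + 1` of the finitely many cones involved,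
reduce each cone to `L/(nᵢ+1)` copies of its base (`tateLifting_coneEngine`), and divide by `L` (torsion-freeness of
`FormalRep ⧸ relations`). No transcendence input. [cite: KontsevichZagier2001, §1.2] -/
theorem coneKernel_allDim (S B : Set KZ.FormalRep)
    (hB : ∀ d ∈ B, ∃ (n : ℕ) (r : KZ.IntegralRep (n + 1)) (s : KZ.IntegralRep n),
      r.domain = {z | z (Fin.last n) ∈ Set.Ioo (0 : ℝ) 1 ∧
        (fun i => (Fin.init z : Fin n → ℝ) i / z (Fin.last n)) ∈ s.domain} ∧
      (∀ z ∈ r.domain, r.integrand z = 1) ∧ (∀ x ∈ s.domain, s.integrand x = 1) ∧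
      (∃ ℓ ∈ AddSubgroup.closure S, KZ.of s - ℓ ∈ KZ.relations) ∧ d = KZ.of r)
    (hK : ∀ c ∈ AddSubgroup.closure S, KZ.eval c = 0 → c ∈ KZ.relations) :
    ∀ c ∈ AddSubgroup.closure B, KZ.eval c = 0 → c ∈ KZ.relations := by
  intro c hc hev
  classical
  rw [← Submodule.span_int_eq_addSubgroupClosure, Submodule.mem_toAddSubgroup,
    Submodule.mem_span_set'] at hc
  obtain ⟨k, f, g, rfl⟩ := hc
  -- per generator: dimension `n i`, base class `ℓ i`, `(n i + 1) • g i ≡ ℓ i`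
  have hred : ∀ i : Fin k, ∃ (n : ℕ) (ℓ : KZ.FormalRep), ℓ ∈ AddSubgroup.closure S ∧
      ((n + 1 : ℕ) : ℤ) • (g i : KZ.FormalRep) - ℓ ∈ KZ.relations := by
    intro i
    obtain ⟨n, r, s, hrd, hri, hsi, ⟨ℓ, hℓ, hsℓ⟩, hgi⟩ := hB (g i) (g i).2
    refine ⟨n, ℓ, hℓ, ?_⟩
    rw [hgi]
    have : ((n + 1 : ℕ) : ℤ) • KZ.of r - ℓ = (((n + 1 : ℕ) : ℤ) • KZ.of r - KZ.of s) + (KZ.of s - ℓ) := by abel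
    rw [this]
    exact KZ.relations.add_mem (tateLifting_coneEngine n r s hrd hri hsi) hsℓ
  choose n ℓ hℓ hrel using hred
  -- the common multiple
  set L : ℕ := Finset.univ.lcm fun i => n i + 1 with hL
  have hLpos : L ≠ 0 := by
    rw [hL, Ne, Finset.lcm_eq_zero_iff]
    rintro ⟨i, -, hi⟩
    exact Nat.succ_ne_zero _ hi
  have hdvd : ∀ i, n i + 1 ∣ L := fun i => Finset.dvd_lcm (Finset.mem_univ i)
  choose q hq using hdvd
  -- `L • g i ≡ q i • ℓ i`
  have hredL : ∀ i, (L : ℤ) • (g i : KZ.FormalRep) - (q i : ℤ) • ℓ i ∈ KZ.relations := by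
    intro i
    have e : (L : ℤ) • (g i : KZ.FormalRep) - (q i : ℤ) • ℓ i =
        (q i : ℤ) • (((n i + 1 : ℕ) : ℤ) • (g i : KZ.FormalRep) - ℓ i) := by
      rw [smul_sub, smul_smul, hq i]
      push_cast
      ring_nf
    rw [e]
    exact KZ.relations.zsmul_mem (hrel i) _
  have hdiff : (L : ℤ) • ∑ i, f i • ((g i : KZ.FormalRep)) - ∑ i, f i • ((q i : ℤ) • ℓ i) ∈ KZ.relations := by
    rw [Finset.smul_sum, ← Finset.sum_sub_distrib]
    refine sum_mem fun i _ => ?_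
    rw [smul_comm, ← smul_sub]
    exact KZ.relations.zsmul_mem (hredL i) _
  have hmem : ∑ i, f i • ((q i : ℤ) • ℓ i) ∈ AddSubgroup.closure S :=
    sum_mem fun i _ => AddSubgroup.zsmul_mem _ (AddSubgroup.zsmul_mem _ (hℓ i) _) _
  have hev' : KZ.eval (∑ i, f i • ((q i : ℤ) • ℓ i)) = 0 := by
    have h0 := KZ.relations_le_ker_eval_holds hdiff
    rw [AddMonoidHom.mem_ker, map_sub, map_zsmul, hev, smul_zero, zero_sub, neg_eq_zero] at h0
    exact h0
  have h := KZ.relations.add_mem hdiff (hK _ hmem hev')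
  rw [sub_add_cancel] at h
  exact (Summit.KontsevichZagierPeriods.KontsevichZagierPeriods.BetaCancellationNegative.zsmul_mem_relations_iff
    (by exact_mod_cast hLpos) _).1 h

end Summit.KontsevichZagierPeriods.InverseLandau

end
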